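import Summits.RiemannHypothesis.RiemannHypothesis.Theses.WeilWindowFlow
import Summits.RiemannHypothesis.RiemannHypothesis.Theorems.WeilWindowFlowWindowLipschitzStubFormDomainPos
import Summits.RiemannHypothesis.RiemannHypothesis.Theorems.WeilWindowFlowWindowLipschitzStubGroundStateEnergy
import Summits.RiemannHypothesis.RiemannHypothesis.Theorems.WeilWindowFlowWindowLipschitzStubEulerLagrange
import Summits.RiemannHypothesis.RiemannHypothesis.Theorems.WeilWindowFlowWindowLipschitzStubSupBound
import Summits.RiemannHypothesis.RiemannHypothesis.Theorems.WeilWindowFlowWindowLipschitzStubLocalizedCut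
import Summits.RiemannHypothesis.RiemannHypothesis.Theorems.WeilWindowFlowDiniLeakageStubRelCommutatorBound
import Literature.NumberTheory.LFunctions.WeilMarkovQuadratic
import Literature.NumberTheory.LFunctions.WeilGroundState
import Literature.NumberTheory.LFunctions.WeilSemilocalCompactnessProofs
import Summits.RiemannHypothesis.RiemannHypothesis.Theorems.WindowLipschitz.Negative.CutDontSqueezeFloors
import HarnessLib.Audit

/-!
# Line `collar-cut-edge-mass` — skeleton for crux `WeilWindowFlow.DiniLeakage`
(item stmt-RiemannHypothesis-1038, route route-RiemannHypothesis-WeilWindowFlow; crux-plan round 1, gen 1, 2026-08-16)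

Crux (BY NAME, never restated): `Summit.RiemannHypothesis.RiemannHypothesis.Theses.WeilWindowFlow.DiniLeakage`
= `∀ b₀ A, 0 < b₀ → b₀ ≤ A → ∃ K, ∀ a ∈ [b₀, A], ∀ η δ > 0, ∃ h ∈ (0, δ), ε a − ε (a + h) ≤ h (K ε a + η)`,
`ε = Literature.NumberTheory.LFunctions.weilGroundEnergy` (the lower right-Dini leakage bound, `K` uniform on
compact window ranges; cdisprove: `diniLeakage_iff_pos_and_lowerRightLipschitz`, `riemannHypothesis_of_diniLeakage`).

## The line (idea card `collar-cut-edge-mass`, crux-ideate r1 ideator 1; triage r1: pass ×3)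

COLLAR CUT.  To compare the windows `a < a + h` take a TRUE ground state `u` of the LARGER window `b := a + h`
(`IsWeilGroundState b u`; existence is the PROVED tree theorem
`ConnesConsaniMoscovici2025_thm_3_6_holds.exists_isWeilGroundState`, used in the glue) and cut it down to the window
`a` with a Lipschitz collar cutoff `χ` (`= 1` on `|x| ≤ b − 2h`, `= 0` on `|x| ≥ b − h = a`).  Ground-state
substitution (the weak Euler–Lagrange identity kills every cross term) and IMS localisation give the LOCALISED
CUT INEQUALITY
`(ε(a) − ε(a+h)) ‖χu‖² ≤ ArchComm + PrimeComm + PolRem`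
— this is the tree THEOREM `Theorems.WeilWindowFlowWindowLipschitz.stub_localizedCut` (landed for the sibling
crux `WindowLipschitz`, line `cut-dont-squeeze`, together with its antecedents `stub_formDomainPos` (C1),
`stub_groundStateEnergy` (C2), `stub_eulerLagrange` (EL) and the uniform sup bound `stub_supBound` (A) — all
sorry-free in `Summits/RiemannHypothesis/RiemannHypothesis/Theorems/`), instantiated here at `(big, small) = (a+h, a)`:
no dilation, no virial, no derivative of any (near-)minimiser, only RIGHT differences at `a` as the crux is typed.
The commutator side is paid by the `L²` EDGE MASS `m_b(r)² := ∫_{b−r<|x|} ‖u‖²` of the ground state: the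
sibling line's commutator estimate (dyadic shells; landed toolkits `…StubCommutatorBoundAux{,2,3,4}`) gives
`ArchComm + PrimeComm + PolRem ≤ C₀ · [sup_{r ≤ r₀} m_b(r)² log(1/r)/r] · h + o(h)` with an ABSOLUTE `C₀` and an
`o(h)` uniform on compact ranges.  Hence the crux follows from ONE statement about ONE function at ONE window:

  **relative edge-mass law** (Stub B♭, the bet, RH-strength):  `m_b(r)² ≤ (K ε(b) + η) · r / log(1/r)` for
  `r ≤ r₀(η)`, uniformly for ground states of windows `b ∈ [b₀, A]` — the edge mass of a ground state is
  SLAVED TO ITS ENERGY (under the sharp edge profile `u ~ T_b (log 1/d)^{-1/2}` this reads `|T_b|² ≲ K ε(b)`: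
  the leakage envelope of the crux IS, up to the absolute factor `2C₀`, the edge-slaving envelope; numerics
  `K(b) ≈ 8πe^{2b}` from `−(log ε)′`, arXiv:2106.01715 §2.5, crux-ideate toy j005797).

Composition: `DiniLeakage_of : DiniLeakage` — zero hypotheses; (B♭) `stub_relEdgeMassLaw` and (E♭)
`stub_relCommutatorBound` enter BY NAME, the cut (D) and its antecedents (C1), (C2), (EL) are the landed theorems,
the glue `diniLeakage_of_relOneStep` (cutoff construction, division by `‖χu‖² ≥ 1/2`, antitonicity
`ε(a+h) ≤ ε(a)`, `K ↦ 2K`, `η ↦ η/2`, `h := min(h₀(η/2), δ/2, 1/2)`, range `[b₀, A+1]` for the big windows) is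
sorry-free.  The bridge `relEdgeMassLaw_of_pointwise` (sorry-free, NOT a stub) lets any POINTWISE relative edge
law `‖u(x)‖² log(1/(b−|x|)) ≤ K ε(b) + η` (edge coefficient slaved to energy) discharge (B♭).

Registered stubs (2): `stub_relEdgeMassLaw` (B♭ — HARDEST, RH-strength: with the cut it implies the crux, hence RH
by cdisprove's `riemannHypothesis_of_diniLeakage`; conversely it follows from strict positivity of `ε` on compact
ranges (route item StrictUnderRH under RH) and the sibling line's ABSOLUTE edge-mass law, so it is RH ∧ regularity,
not more) · `stub_relCommutatorBound` (E♭ — unconditional hard analysis, size M/L: the sibling's Stub E redone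
with `K_B`-homogeneous bookkeeping and an `η`-slack).

Disproof.lean honoured (refuter-cdisprove-1038, cycle 1, rc0 sorry-free; published to `Cruxes/DiniLeakage/Disproof.lean`
2026-08-16T04:50Z and READ IN FULL at the publish boundary of this skeleton — before that only its evidence notes were
reachable, as for all three triagers): `diniLeakage_false_without_b0_pos` /
`not_diniLeakageUniformK` / `not_lowerRightLipschitz_without_b0_pos` — the floor `0 < b₀` is USED: (E♭) needs the
sup bound (A) and opposite-edge separation `ρ(b₀)`, (B♭)'s constant must blow up as `b₀ → 0⁺`
(rate `K(a) ≍ 1/(a log(1/a))` as `a → 0⁺`, Disproof finding 3, from `ε(a) = log(1/a) + O(1)`; cf. the landed `Theorems/WindowLipschitz/Negative/CutDontSqueezeFloors.lean`: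
`edgeMassLaw_false_without_floor`, `supBound_false_without_floor` — (B♭) restricted to a range with `ε` bounded
implies the absolute law, so it inherits those floors and is stated on `[b₀, A]` only); `diniLeakage_iff_eta0`
(η decorative in the crux) — here `η` is GENUINELY used inside (B♭)/(E♭) to absorb the `o(h)` terms, and the
composition produces the crux with its `η`; near-miss VirialLeakage (∀-form FALSE beyond the dyadic window,
triage r1-2/r1-3, W1.lean) — AVOIDED: no virial, no near-minimiser, only true ground states.
`ledger negatives --problem RiemannHypothesis`: 0 (2026-08-16); no `Theorems/…/DiniLeakage/Negative/` exists; the landed Negative lemmas of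
the shared cut machinery (`Theorems/WindowLipschitz/Negative/CutDontSqueezeFloors.lean`, crux 1039) are IMPORTED above and respected
(see `absEdgeMassLaw_of_rel`).

## Lead's status (prover-line-stmt-RiemannHypothesis-1038-0, 2026-08-16; rev L1)

* (E♭) `stub_relCommutatorBound` is LANDED: `Summit.RiemannHypothesis.RiemannHypothesis.Theorems.WeilWindowFlowDiniLeakage.stub_relCommutatorBound`
  (p87558, `Theorems/WeilWindowFlowDiniLeakageStubRelCommutatorBound.lean`; κ-homogeneous toolkit p85660
  `…StubRelCommutatorBoundAux.lean`: the landed 1039 toolkits re-run on `u/√κ`, main terms `≤ 128 κ h`, the rest `o(h)`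
  uniformly and absorbed by the `η`-slack; `K' = 128 K`).  Below, the stub's body is that theorem (no `sorry`).
* The ONLY remaining `sorry` is (B♭) `stub_relEdgeMassLaw`, and it is CALIBRATED by tree theorems:
  `Theorems/WeilWindowFlowDiniLeakageCalibration.lean` (p88520) proves `DiniLeakage ↔ RiemannHypothesis ∧ WindowLipschitz`
  (the crux is exactly the summit ∧ item 1039), and `Theorems/WeilWindowFlowDiniLeakageRelEdgeMassLaw.lean` proves
  `diniLeakage_of_relEdgeMassLaw : (B♭) → DiniLeakage` (this skeleton's composition, landed) and
  `relEdgeMassLaw_iff_riemannHypothesis_and_absEdgeMassLaw : (B♭) ↔ RiemannHypothesis ∧ (absolute L² edge-mass law)`,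
  the absolute law being hypothesis (B) of the landed `…WindowLipschitz.stub_commutatorBound` (item 1039's regularity bet).
  So B♭ is summit-strength by theorem; no worker can close it; the line is complete modulo the summit itself.
* FINAL (07:19Z): the sibling crux `WindowLipschitz` is PROVED (`…Theorems.WeilWindowFlowWindowLipschitz.WindowLipschitz_proof`),
  hence `diniLeakage_iff_riemannHypothesis : DiniLeakage ↔ RiemannHypothesis` and `relEdgeMassLaw_iff_riemannHypothesis :
  (B♭) ↔ RiemannHypothesis` (same file `Theorems/WeilWindowFlowDiniLeakageRelEdgeMassLaw.lean`): the crux AND the bet are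
  each exactly the Riemann hypothesis. The remaining `sorry` below is RH itself.
-/

set_option linter.dupNamespace false

noncomputable section

open MeasureTheory Set Filter
open scoped Topology ENNReal NNReal

namespace Summit.RiemannHypothesis.RiemannHypothesis.Cruxes.DiniLeakage.CollarCutEdgeMass

open Literature.NumberTheory.LFunctions
open Summit.RiemannHypothesis.RiemannHypothesis.Theses.WeilWindowFlow (DiniLeakage)

/-! ### The two registered stubs -/

/-- **Stub B♭ `stub_relEdgeMassLaw` — the RELATIVE `L²` edge-mass law (the bet of the line; HARDEST; RH-strength).**
On every compact window range `[b₀, A] ⊂ (0, ∞)` there is `K ≥ 0` such that for every slack `η > 0` there is a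
depth `r₀ = r₀(η, b₀, A) ∈ (0, 1)` with
`∫_{a − r < |x|} ‖u‖² ≤ (K ε(a) + η) · r / log(1/r)`  for all `0 < r ≤ r₀`,
for every ground state `u` of every window `a ∈ [b₀, A]` (`ε = weilGroundEnergy`).  Under the sharp edge profile
`u(x) ~ T^{±} (log(1/(a − |x|)))^{-1/2}` (exponent ½: Hernández-Santamaría–Ríos–Saldaña arXiv:2401.18033 Thms 1.1–1.2
for the model log-Laplacian; the tree's arch density is `ρ(t) = 1/(2t) + O(1)` at `0⁺`) one has
`m(r)² log(1/r)/r → |T⁺|² + |T⁻|²`, so the law says: THE EDGE COEFFICIENT OF A GROUND STATE IS SLAVED TO ITS ENERGY,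
`|T_a|² ≤ K ε(a)`, uniformly on compact ranges.  Why plausibly true: (i) under RH, `ε > 0` on `(0, ∞)` (route item
StrictUnderRH) and `ε` is continuous (PROVED, `continuousAt_weilGroundEnergy`), so `min_{[b₀,A]} ε > 0` and the law
follows from the ABSOLUTE edge-mass law of the sibling line (`cut-dont-squeeze` Stub B / `stub_edgeLaw`, unconditional,
exponent ½) with `K := K_abs / min ε` — i.e. the stub is RH ∧ (unconditional regularity), not stronger; (ii) the
Hadamard picture `−ε′(a) = c |T_a|²` (Bombieri2000Weil Lemma 5: edge Diracs of extremals; numerics j006705: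
`−ε′ ≈ 12·edge²`) makes it the pointwise form of `−(log ε)′ ≤ K`, observed with `K(a) ≈ 8πe^{2a}`
(arXiv:2106.01715 §2.5: `log ε` linear in `e^{2a}` down to `2.4e-48`; toy j005797); (iii) spectral side under RH:
`ε(a) = Σ_γ |û(½+iγ)|² ≥ Σ_{γ>U} |û|² ≈ |T_a|²/(2πU)` (edge singularity ⇒ Fourier tail `|û|² ~ |T|²/(γ² log γ)` against
zero density `log γ/2π`), i.e. slaving at the Nyquist/plunge height `U ≍ e^{2a}`.  Why it might fail: it is
RH-strength — with (E♭) and the landed cut it implies the crux, hence RH (cdisprove `riemannHypothesis_of_diniLeakage`);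
unconditionally nothing beyond `ε ≥ 0 ⟸ ?` is known; a conjugate point (`ε(a*) = 0` with `T_{a*} ≠ 0`) kills it.
The floor `0 < b₀` is load-bearing (`K(b₀) ≳ 1/(b₀ log(1/b₀))` as `b₀ → 0⁺`: Disproof.lean finding 3 gives the true crux
rate `K(a) ≍ 1/(a log(1/a))` from `ε(a) = log(1/a) + O(1)`, and (B♭) ⟹ crux with `K ↦ 2C₀K`; on a range with `ε` bounded
the law contains the absolute law, `absEdgeMassLaw_of_rel`, hence Negative/CutDontSqueezeFloors applies too).
Quantitative conjecture behind it (NOT registered, the line's cheapest falsifier): `K(b₀, A) ≤ C (e^{2A} + 1/b₀)` with an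
absolute `C` (edge slaving at the Nyquist rate).  Sources: Bombieri2000Weil §4 (Problem 2, (4.2), Thm 3), Lemma 5;
arXiv:2106.01715 §§2.2–2.5; arXiv:2401.18033 Thms 1.1, 1.2, 1.4; arXiv:2010.10448 Thm 1.1/Cor 1.4; card
`collar-cut-edge-mass` (EdgeMassLaw); triage r1-2 (state it for `IsWeilGroundState`, `log(1/h)` inside, uniformly in
the window), r1-3 (lim sup form, uniform on `[b₀, A]`). -/
theorem stub_relEdgeMassLaw :
    ∀ b₀ A : ℝ, 0 < b₀ → b₀ ≤ A → ∃ K : ℝ, 0 ≤ K ∧ ∀ η : ℝ, 0 < η → ∃ r₀ : ℝ, 0 < r₀ ∧ r₀ < 1 ∧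
      ∀ (a r : ℝ) (u : ℝ → ℂ), b₀ ≤ a → a ≤ A → IsWeilGroundState a u → 0 < r → r ≤ r₀ →
        ∫ x in {x : ℝ | a - r < |x|}, ‖u x‖ ^ 2 ≤
          (K * weilGroundEnergy a + η) * r / Real.log (1 / r) := by
  sorry

/-- **Stub E♭ `stub_relCommutatorBound` — the RELATIVE commutator bound (unconditional; size M/L; hard analysis only).**
From the relative edge-mass law (B♭): on every compact window range `[b₀, A]` there is `K' ≥ 0` such that for every
`η > 0` there is `h₀ = h₀(η, b₀, A) > 0` with: for every window `a ∈ [b₀, A]`, every width `0 < h ≤ h₀`, every ground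
state `u` of the window `a` and every ADMISSIBLE CUTOFF `χ` (slope `≤ 1/h`, values in `[0, 1]`, `= 1` on
`|x| ≤ a − 2h`, `= 0` on `|x| ≥ a − h`) the right-hand side of the localised cut inequality
(`Theorems.WeilWindowFlowWindowLipschitz.stub_localizedCut`: `ArchComm + PrimeComm + PolRem`, verbatim below) is
`≤ h · (K' ε(a) + η)`, and `∫ ‖χu‖² ≥ 1/2`.
Proof route (= the sibling line's Stub E `stub_commutatorBound`, whose toolkits `…StubCommutatorBoundAux`,
`Aux2`, `Aux3`, `Aux4` are LANDED, redone with `K_B`-HOMOGENEOUS constants; write `K_B := K ε(a) + η₁` for the datum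
of (B♭) at slack `η₁`, `m(r)² := ∫_{a−r<|x|}‖u‖² ≤ K_B r/log(1/r)` for `r ≤ r₀(η₁)`; if `K_B < 0` then (B♭) at `r = r₀`
is absurd (`0 ≤ ∫`), so assume `K_B ≥ 0`; the sup bound `‖u‖ ≤ K_A(b₀, A)` a.e. is the LANDED theorem
`stub_supBound stub_groundStateEnergy (stub_eulerLagrange stub_formDomainPos stub_groundStateEnergy)`; every live
pair of the commutator has one point in the edge zone `E = {a − 2h < |x| < a}`, `∫_E |u| ≤ (4h)^{1/2} m(2h)
≤ 2√2 · h · (K_B / log(1/2h))^{1/2}`):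
(I) partner within depth `4h` on the same side: `(χ(x) − χ(y))² ≤ min(1, |x−y|²/h²)`, Schur with
`∫₀^{4h} min(1, t²/h²) ρ ≤ 1/2 + log 4` ⇒ `≤ 2(1/2 + log 4) m(4h)² = O(K_B h / log(1/h))`;
(II) partner at depth in `[4h, r₀]`, same side, dyadic shells `S_j = {2^j h ≤ a − |y| < 2^{j+1} h}`:
`ρ ≤ 1/(2^{j−1}h)` there (`ρ(t) ≤ 1/t`, `stub_commutatorBound_rho_le_inv`), `∫_{S_j}|u| ≤ |S_j|^{1/2} m(2^{j+1}h)`, so the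
potential is `≤ Σ_j 4 (K_B / log(1/(2^{j+1}h)))^{1/2} ≤ (8/log 2) (K_B log(1/h))^{1/2}` (Cauchy–Schwarz SHELL BY
SHELL; the two half-powers of `log(1/h)` cancel against `∫_E|u|`) ⇒ `≤ C₀ K_B h` with an ABSOLUTE `C₀`;
(II′) partner deeper than `r₀`: `ρ ≤ ρ(r₀/2)`, `‖u‖₁ ≤ (2A + 1)/2` ⇒ `O(h (K_B/log(1/h))^{1/2} ρ(r₀/2) A)`;
(III) partner on the opposite side: `|x − y| ≥ 2b₀ − 6h ≥ b₀`, `ρ ≤ ρ(b₀)` ⇒ same order as (II′);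
primes: a live prime pair has one point in `E` and `|u| ≤ K_A` at the partner ⇒ `≤ 2 S_A K_A ∫_E|u|
= O(h (K_B/log(1/h))^{1/2})`, `S_A = Σ_{log n<2A} Λ(n)n^{-1/2}`;
poles: `|∫θu ch| ≤ cosh(A/2) ∫_E|u|`, `|∫u ch| ≤ cosh(A/2)(2A+1)/2` ⇒ `O(h (K_B/log(1/h))^{1/2})` and `O(h²/log)`;
mass: `∫‖χu‖² ≥ 1 − m(2h)² ≥ 1 − 2K_B h/log(1/2h) ≥ 1/2`.
Total: `RHS ≤ C₀ K_B h + C₁(b₀, A, K_A, S_A, r₀) · (K_B^{1/2} + K_B) · h / (log(1/h))^{1/2}`; with `K_B ≤ K ε(b₀) + η₁`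
(`ε` antitone) choose `h₀(η)` so small that the second term is `≤ η₁ h`, and take `η₁ := η/(C₀ + 1)`, `K' := C₀ K`.
The floor `0 < b₀` enters through (A), (III) and `ε(b₀)`.  Sources: line card `Cruxes/WindowLipschitz/Lines/cut-dont-squeeze.md`
§Stub E (the absolute computation, hand-checked by its triage ×3; numerics j005651: cut-cost/h flat over six decades);
Cycon–Froese–Kirsch–Simon, Schrödinger Operators, Thm 3.2 (IMS).  Why it might fail: it does not in substance (it is
the absolute Stub E with the constant's `K_B`-dependence tracked: every live pair carries a factor `m(·) ∝ K_B^{1/2}` from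
its edge-zone point); the Lean size is re-running Toolkit III/IV (`stub_commutatorBound_layer_le`, `_core`) without the
`(1 + K_B)` shortcuts. -/
theorem stub_relCommutatorBound :
    (∀ b₀ A : ℝ, 0 < b₀ → b₀ ≤ A → ∃ K : ℝ, 0 ≤ K ∧ ∀ η : ℝ, 0 < η → ∃ r₀ : ℝ, 0 < r₀ ∧ r₀ < 1 ∧
      ∀ (a r : ℝ) (u : ℝ → ℂ), b₀ ≤ a → a ≤ A → IsWeilGroundState a u → 0 < r → r ≤ r₀ →
        ∫ x in {x : ℝ | a - r < |x|}, ‖u x‖ ^ 2 ≤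
          (K * weilGroundEnergy a + η) * r / Real.log (1 / r)) →
    ∀ b₀ A : ℝ, 0 < b₀ → b₀ ≤ A → ∃ K : ℝ, 0 ≤ K ∧ ∀ η : ℝ, 0 < η → ∃ h₀ : ℝ, 0 < h₀ ∧
        ∀ (a h : ℝ) (u : ℝ → ℂ) (χ : ℝ → ℝ), b₀ ≤ a → a ≤ A → 0 < h → h ≤ h₀ →
        IsWeilGroundState a u → (∀ x y, |χ x - χ y| ≤ |x - y| / h) → (∀ x, 0 ≤ χ x ∧ χ x ≤ 1) →
        (∀ x, |x| ≤ a - 2 * h → χ x = 1) → (∀ x, a - h ≤ |x| → χ x = 0) →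
        (∫ t in Ioi (0 : ℝ), weilArchDensity t *
              ∫ x, (χ (x + t) - χ x) ^ 2 * (‖u (x + t)‖ * ‖u x‖)) +
          (∑ n ∈ weilPrimeIndex a, (ArithmeticFunction.vonMangoldt n : ℝ) / Real.sqrt n *
              ∫ x, (χ (x + Real.log n) - χ x) ^ 2 * (‖u (x + Real.log n)‖ * ‖u x‖)) +
          2 * ‖∫ t, ((1 - χ t : ℝ) : ℂ) * u t * (Real.cosh (t / 2) : ℂ)‖ ^ 2 +
          2 * ‖∫ t, u t * (Real.cosh (t / 2) : ℂ)‖ *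
              ‖∫ t, (((1 - χ t) ^ 2 : ℝ) : ℂ) * u t * (Real.cosh (t / 2) : ℂ)‖ +
          2 * ‖∫ t, u t * (Real.sinh (t / 2) : ℂ)‖ *
              ‖∫ t, (((1 - χ t) ^ 2 : ℝ) : ℂ) * u t * (Real.sinh (t / 2) : ℂ)‖ ≤
            h * (K * weilGroundEnergy a + η) ∧
          1 / 2 ≤ ∫ x, ‖(χ x : ℂ) * u x‖ ^ 2 :=
  -- LANDED (p87558, worker wave 1 of the line lead, 2026-08-16): the relative commutator bound, by the
  -- κ-homogeneous rescaling `u ↦ u/√κ` of the landed toolkits of `…WindowLipschitz.stub_commutatorBound`.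
  _root_.Summit.RiemannHypothesis.RiemannHypothesis.Theorems.WeilWindowFlowDiniLeakage.stub_relCommutatorBound

/-! ### Sorry-free glue -/

/-- Antitonicity of the window bottom (`sInf` over a larger, still bounded-below set; the smaller sphere is
nonempty).  Same statement as the sibling skeleton's `weilGroundEnergy_antitone`, the landed
`stub_supBound_weilGroundEnergy_anti` and the disprover's `eps_antitoneOn`. -/
theorem weilGroundEnergy_antitone {a b : ℝ} (hb : 0 < b) (hba : b ≤ a) :
    weilGroundEnergy a ≤ weilGroundEnergy b := by
  obtain ⟨g, hg, hs, hn⟩ := exists_isWeilTest_sphere hb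
  refine le_csInf ⟨_, g, hg, hs, hn, rfl⟩ ?_
  rintro x ⟨h, hh, hhs, hhn, rfl⟩
  exact csInf_le (bddBelow_weilQuadratic_sphere_holds a)
    ⟨h, hh, hhs.trans (Icc_subset_Icc (neg_le_neg hba) hba), hhn, rfl⟩

/-- **The crux body from the cut (D) and the relative commutator bound (E♭-conclusion)** (sorry-free; hypotheses are
STATEMENTS, the conclusion is the crux UNFOLDED — `DiniLeakage_of` below concludes it by name).  For `a ∈ [b₀, A]`,
`η, δ > 0`: take `K', h₀(η/2)` from (E♭) on the range `[b₀, A + 1]`, the width `h := min(h₀, δ/2, 1/2)`, the big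
window `b := a + h ∈ [b₀, A + 1]`, a ground state `u` of the window `b`
(`ConnesConsaniMoscovici2025_thm_3_6_holds.exists_isWeilGroundState`, PROVED) and the piecewise-linear collar cutoff
`χ(x) = max(min((b − h − |x|)/h, 1), 0)` (`= 0` on `|x| ≥ a`); (D) at `(b, a)` and (E♭) give
`(ε(a) − ε(b)) ∫‖χu‖² ≤ h (K' ε(b) + η/2)` with `∫‖χu‖² ≥ 1/2` and `0 ≤ ε(a) − ε(b)`, `ε(b) ≤ ε(a)` (antitone), whence
`ε(a) − ε(a+h) ≤ h (2K' ε(a) + η)`. -/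
theorem diniLeakage_of_relOneStep
    (hD : ∀ (a b : ℝ) (K : ℝ≥0) (u : ℝ → ℂ) (χ : ℝ → ℝ), 0 < b → b ≤ a → IsWeilGroundState a u →
        LipschitzWith K χ → (∀ x, 0 ≤ χ x ∧ χ x ≤ 1) → (∀ x, b ≤ |x| → χ x = 0) →
        (weilGroundEnergy b - weilGroundEnergy a) * ∫ x, ‖(χ x : ℂ) * u x‖ ^ 2 ≤
          (∫ t in Ioi (0 : ℝ), weilArchDensity t *
              ∫ x, (χ (x + t) - χ x) ^ 2 * (‖u (x + t)‖ * ‖u x‖)) +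
          (∑ n ∈ weilPrimeIndex a, (ArithmeticFunction.vonMangoldt n : ℝ) / Real.sqrt n *
              ∫ x, (χ (x + Real.log n) - χ x) ^ 2 * (‖u (x + Real.log n)‖ * ‖u x‖)) +
          2 * ‖∫ t, ((1 - χ t : ℝ) : ℂ) * u t * (Real.cosh (t / 2) : ℂ)‖ ^ 2 +
          2 * ‖∫ t, u t * (Real.cosh (t / 2) : ℂ)‖ *
              ‖∫ t, (((1 - χ t) ^ 2 : ℝ) : ℂ) * u t * (Real.cosh (t / 2) : ℂ)‖ +
          2 * ‖∫ t, u t * (Real.sinh (t / 2) : ℂ)‖ *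
              ‖∫ t, (((1 - χ t) ^ 2 : ℝ) : ℂ) * u t * (Real.sinh (t / 2) : ℂ)‖)
    (hE : ∀ b₀ A : ℝ, 0 < b₀ → b₀ ≤ A → ∃ K : ℝ, 0 ≤ K ∧ ∀ η : ℝ, 0 < η → ∃ h₀ : ℝ, 0 < h₀ ∧
        ∀ (a h : ℝ) (u : ℝ → ℂ) (χ : ℝ → ℝ), b₀ ≤ a → a ≤ A → 0 < h → h ≤ h₀ →
        IsWeilGroundState a u → (∀ x y, |χ x - χ y| ≤ |x - y| / h) → (∀ x, 0 ≤ χ x ∧ χ x ≤ 1) →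
        (∀ x, |x| ≤ a - 2 * h → χ x = 1) → (∀ x, a - h ≤ |x| → χ x = 0) →
        (∫ t in Ioi (0 : ℝ), weilArchDensity t *
              ∫ x, (χ (x + t) - χ x) ^ 2 * (‖u (x + t)‖ * ‖u x‖)) +
          (∑ n ∈ weilPrimeIndex a, (ArithmeticFunction.vonMangoldt n : ℝ) / Real.sqrt n *
              ∫ x, (χ (x + Real.log n) - χ x) ^ 2 * (‖u (x + Real.log n)‖ * ‖u x‖)) +
          2 * ‖∫ t, ((1 - χ t : ℝ) : ℂ) * u t * (Real.cosh (t / 2) : ℂ)‖ ^ 2 +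
          2 * ‖∫ t, u t * (Real.cosh (t / 2) : ℂ)‖ *
              ‖∫ t, (((1 - χ t) ^ 2 : ℝ) : ℂ) * u t * (Real.cosh (t / 2) : ℂ)‖ +
          2 * ‖∫ t, u t * (Real.sinh (t / 2) : ℂ)‖ *
              ‖∫ t, (((1 - χ t) ^ 2 : ℝ) : ℂ) * u t * (Real.sinh (t / 2) : ℂ)‖ ≤
            h * (K * weilGroundEnergy a + η) ∧
          1 / 2 ≤ ∫ x, ‖(χ x : ℂ) * u x‖ ^ 2) :
    ∀ b₀ A : ℝ, 0 < b₀ → b₀ ≤ A → ∃ K : ℝ, ∀ a : ℝ, b₀ ≤ a → a ≤ A → ∀ η δ : ℝ, 0 < η → 0 < δ →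
      ∃ h : ℝ, 0 < h ∧ h < δ ∧
        weilGroundEnergy a - weilGroundEnergy (a + h) ≤ h * (K * weilGroundEnergy a + η) := by
  intro b₀ A hb₀ hb₀A
  obtain ⟨K, hK0, hK⟩ := hE b₀ (A + 1) hb₀ (by linarith)
  refine ⟨2 * K, ?_⟩
  intro a ha haA η δ hη hδ
  obtain ⟨h₀, hh₀, hest⟩ := hK (η / 2) (by positivity)
  -- the width of the collar
  set h : ℝ := min h₀ (min (δ / 2) (1 / 2)) with hhdef
  have hh : 0 < h := lt_min hh₀ (lt_min (by positivity) (by norm_num))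
  have hhh₀ : h ≤ h₀ := min_le_left _ _
  have hhδ : h < δ := by
    have h1 : h ≤ δ / 2 := (min_le_right _ _).trans (min_le_left _ _)
    linarith
  have hh1 : h ≤ 1 / 2 := (min_le_right _ _).trans (min_le_right _ _)
  refine ⟨h, hh, hhδ, ?_⟩
  have ha0 : 0 < a := lt_of_lt_of_le hb₀ ha
  -- the big window `b = a + h` and its ground state
  set b : ℝ := a + h with hbdef
  have hab : a ≤ b := by simp only [hbdef]; linarith
  have hb0 : 0 < b := lt_of_lt_of_le ha0 hab
  have hb₀b : b₀ ≤ b := ha.trans hab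
  have hbA : b ≤ A + 1 := by simp only [hbdef]; linarith
  obtain ⟨u, hu⟩ := ConnesConsaniMoscovici2025_thm_3_6_holds.exists_isWeilGroundState hb0
  -- the piecewise-linear collar cutoff of width `h` at the window `b` (vanishes on `|x| ≥ b - h = a`)
  set χ : ℝ → ℝ := fun x ↦ max (min ((b - h - |x|) / h) 1) 0 with hχdef
  have hχ01 : ∀ x, 0 ≤ χ x ∧ χ x ≤ 1 := fun x ↦
    ⟨le_max_right _ _, max_le (min_le_right _ _) zero_le_one⟩
  have hχone : ∀ x, |x| ≤ b - 2 * h → χ x = 1 := by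
    intro x hx
    have h1p : 1 ≤ (b - h - |x|) / h := by
      rw [le_div_iff₀ hh]
      linarith
    show max (min ((b - h - |x|) / h) 1) 0 = 1
    rw [min_eq_right h1p, max_eq_left (zero_le_one' ℝ)]
  have hχzero : ∀ x, b - h ≤ |x| → χ x = 0 := by
    intro x hx
    have hp : (b - h - |x|) / h ≤ 0 := by
      rw [div_le_iff₀ hh, zero_mul]
      linarith
    show max (min ((b - h - |x|) / h) 1) 0 = 0
    exact max_eq_right ((min_le_left _ _).trans hp)
  have hχzero' : ∀ x, a ≤ |x| → χ x = 0 := fun x hx ↦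
    hχzero x (by simp only [hbdef]; linarith)
  have hχlip : ∀ x y, |χ x - χ y| ≤ |x - y| / h := by
    intro x y
    calc |χ x - χ y|
        = |max (min ((b - h - |x|) / h) 1) 0 - max (min ((b - h - |y|) / h) 1) 0| := rfl
      _ ≤ |min ((b - h - |x|) / h) 1 - min ((b - h - |y|) / h) 1| := abs_max_sub_max_le_abs _ _ _
      _ ≤ max |(b - h - |x|) / h - (b - h - |y|) / h| |(1 : ℝ) - 1| := abs_min_sub_min_le_max _ _ _ _
      _ = |(b - h - |x|) / h - (b - h - |y|) / h| := by
          rw [sub_self, abs_zero, max_eq_left (abs_nonneg _)]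
      _ = |(|y| - |x|)| / h := by
          rw [show (b - h - |x|) / h - (b - h - |y|) / h = (|y| - |x|) / h by ring, abs_div,
            abs_of_pos hh]
      _ ≤ |x - y| / h := by
          rw [div_le_div_iff_of_pos_right hh, abs_sub_comm x y]
          exact abs_abs_sub_abs_le_abs_sub y x
  have hχLW : LipschitzWith (Real.toNNReal (1 / h)) χ := by
    refine LipschitzWith.of_dist_le_mul fun x y ↦ ?_
    rw [Real.dist_eq, Real.dist_eq, Real.coe_toNNReal _ (by positivity)]
    calc |χ x - χ y| ≤ |x - y| / h := hχlip x y
      _ = 1 / h * |x - y| := by ring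
  -- (D) at `(big, small) = (b, a)` and (E♭) at the window `b` with slack `η/2`
  have hcut := hD b a (Real.toNNReal (1 / h)) u χ ha0 hab hu hχLW hχ01 hχzero'
  obtain ⟨hR, hm⟩ := hest b h u χ hb₀b hbA hh hhh₀ hu hχlip hχ01 hχone hχzero
  have hanti : 0 ≤ weilGroundEnergy a - weilGroundEnergy b :=
    sub_nonneg.2 (weilGroundEnergy_antitone ha0 hab)
  have h1 : (weilGroundEnergy a - weilGroundEnergy b) * (1 / 2) ≤
      h * (K * weilGroundEnergy b + η / 2) :=
    le_trans (mul_le_mul_of_nonneg_left hm hanti) (hcut.trans hR)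
  have e1 : h * (K * weilGroundEnergy b + η / 2) = h * (K * weilGroundEnergy b) + h * η / 2 := by ring
  have h2 : K * weilGroundEnergy b ≤ K * weilGroundEnergy a :=
    mul_le_mul_of_nonneg_left (weilGroundEnergy_antitone ha0 hab) hK0
  have h3 : h * (K * weilGroundEnergy b) ≤ h * (K * weilGroundEnergy a) :=
    mul_le_mul_of_nonneg_left h2 hh.le
  have e2 : h * (2 * K * weilGroundEnergy a + η) = 2 * (h * (K * weilGroundEnergy a)) + h * η := by ring
  rw [e2]
  rw [e1] at h1
  linarith

/-! ### The composition (concludes the crux BY NAME; the two stubs enter BY NAME) -/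

/-- **`DiniLeakage` from the two registered stubs** — the skeleton's crux proof term: the localised cut (D) is the
LANDED theorem `Theorems.WeilWindowFlowWindowLipschitz.stub_localizedCut` fed with the LANDED (C1)
`stub_formDomainPos`, (C2) `stub_groundStateEnergy`, (EL) `stub_eulerLagrange C1 C2`; the relative commutator bound is
`stub_relCommutatorBound stub_relEdgeMassLaw` (E♭ applied to B♭); `diniLeakage_of_relOneStep` is the glue.
No hypotheses; `sorry` only inside the two `stub_*`. -/
theorem DiniLeakage_of : DiniLeakage := by
  have hC1 := Summit.RiemannHypothesis.RiemannHypothesis.Theorems.WeilWindowFlowWindowLipschitz.stub_formDomainPos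
  have hC2 := Summit.RiemannHypothesis.RiemannHypothesis.Theorems.WeilWindowFlowWindowLipschitz.stub_groundStateEnergy
  have hEL :=
    Summit.RiemannHypothesis.RiemannHypothesis.Theorems.WeilWindowFlowWindowLipschitz.stub_eulerLagrange hC1 hC2
  have hD :=
    Summit.RiemannHypothesis.RiemannHypothesis.Theorems.WeilWindowFlowWindowLipschitz.stub_localizedCut hC1 hC2 hEL
  have hB := stub_relEdgeMassLaw
  have hE := stub_relCommutatorBound hB
  exact diniLeakage_of_relOneStep hD hE

/-! ### Bridge from the pointwise relative edge law (sorry-free; NOT a stub) -/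

/-- **The pointwise relative edge law implies the relative edge-mass law (Stub B♭'s statement).**  If on `[b₀, A]`
there is `K ≥ 0` such that for every `η > 0` there is `r₀ ∈ (0, 1)` with `‖u(x)‖² · log(1/(a − |x|)) ≤ K ε(a) + η` for
a.e. `x` with `a − r₀ < |x| < a`, for every ground state `u` of every window `a ∈ [b₀, A]` (EDGE COEFFICIENT SLAVED TO
ENERGY — the relative form of the sibling lines' pointwise edge law `stub_edgeLaw` / HS-LR-S arXiv:2401.18033), then
(B♭) holds with `K ↦ 2K` (and `η ↦ 2η`, `r₀ ↦ min r₀ (1/2)`): `u = 0` a.e. off `[−a, a]`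
(`IsWeilGroundState.ae_eq_zero_of_notMem`), the layer `{a − r < |x| ≤ a}` has measure `≤ 2r`, and on it
`log(1/(a−|x|)) ≥ log(1/r) > 0`; a negative `K ε(a) + η` is excluded because the a.e. bound would empty the interval
`(a − min(r₀, a), a)`.  So a worker holding ANY pointwise engine discharges (B♭) by `exact relEdgeMassLaw_of_pointwise h`. -/
theorem relEdgeMassLaw_of_pointwise
    (hP : ∀ b₀ A : ℝ, 0 < b₀ → b₀ ≤ A → ∃ K : ℝ, 0 ≤ K ∧ ∀ η : ℝ, 0 < η → ∃ r₀ : ℝ, 0 < r₀ ∧ r₀ < 1 ∧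
      ∀ (a : ℝ) (u : ℝ → ℂ), b₀ ≤ a → a ≤ A → IsWeilGroundState a u →
        ∀ᵐ x : ℝ, a - r₀ < |x| → |x| < a →
          ‖u x‖ ^ 2 * Real.log (1 / (a - |x|)) ≤ K * weilGroundEnergy a + η) :
    ∀ b₀ A : ℝ, 0 < b₀ → b₀ ≤ A → ∃ K : ℝ, 0 ≤ K ∧ ∀ η : ℝ, 0 < η → ∃ r₀ : ℝ, 0 < r₀ ∧ r₀ < 1 ∧
      ∀ (a r : ℝ) (u : ℝ → ℂ), b₀ ≤ a → a ≤ A → IsWeilGroundState a u → 0 < r → r ≤ r₀ →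
        ∫ x in {x : ℝ | a - r < |x|}, ‖u x‖ ^ 2 ≤
          (K * weilGroundEnergy a + η) * r / Real.log (1 / r) := by
  intro b₀ A hb₀ hb₀A
  obtain ⟨K, hK0, hK⟩ := hP b₀ A hb₀ hb₀A
  refine ⟨2 * K, by positivity, ?_⟩
  intro η hη
  obtain ⟨r₀, hr₀, hr₀1, hPt⟩ := hK (η / 2) (by positivity)
  refine ⟨r₀, hr₀, hr₀1, ?_⟩
  intro a r u ha haA hu hr hrd
  have ha0 : 0 < a := lt_of_lt_of_le hb₀ ha
  set c : ℝ := K * weilGroundEnergy a + η / 2 with hcdef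
  have hr1 : r < 1 := lt_of_le_of_lt hrd hr₀1
  have hlogr : 0 < Real.log (1 / r) := by
    apply Real.log_pos
    rw [lt_div_iff₀ hr, one_mul]
    exact hr1
  -- the a.e. pointwise bound on the layer of depth `r₀`
  have hPx := hPt a u ha haA hu
  -- Step 0: the constant `c` is non-negative (else the layer `(a - min r₀ a, a)` would be null)
  have hc0 : 0 ≤ c := by
    by_contra hneg
    push Not at hneg
    set s : ℝ := min r₀ a with hsdef
    have hs : 0 < s := lt_min hr₀ ha0
    have hsr : s ≤ r₀ := min_le_left _ _
    have hsa : s ≤ a := min_le_right _ _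
    have hnull : ∀ᵐ x : ℝ, x ∉ Ioo (a - s) a := by
      filter_upwards [hPx] with x hx hxI
      have hx0 : 0 < x := by
        have : 0 ≤ a - s := by linarith
        exact lt_of_le_of_lt this hxI.1
      have habs : |x| = x := abs_of_pos hx0
      have h1 : a - r₀ < |x| := by rw [habs]; linarith [hxI.1]
      have h2 : |x| < a := by rw [habs]; exact hxI.2
      have hd : 0 < a - |x| := sub_pos.2 h2
      have hd1 : a - |x| < 1 := by rw [habs]; linarith [hxI.1]
      have hlog : 0 ≤ Real.log (1 / (a - |x|)) := by
        apply Real.log_nonneg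
        rw [le_div_iff₀ hd, one_mul]
        exact hd1.le
      have h3 := hx h1 h2
      have h4 : 0 ≤ ‖u x‖ ^ 2 * Real.log (1 / (a - |x|)) := mul_nonneg (by positivity) hlog
      linarith
    have hvol : volume (Ioo (a - s) a) = 0 := measure_eq_zero_iff_ae_notMem.2 hnull
    rw [Real.volume_Ioo] at hvol
    have : a - (a - s) ≤ 0 := ENNReal.ofReal_eq_zero.1 hvol
    linarith
  have hc0' : 0 ≤ c / Real.log (1 / r) := div_nonneg hc0 hlogr.le
  have hSm : MeasurableSet {x : ℝ | a - r < |x|} :=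
    (isOpen_lt continuous_const continuous_abs).measurableSet
  -- Step 1: the integral over the (infinite-measure) set is the integral over its trace on the window
  have hind : ∀ᵐ x : ℝ, ‖u x‖ ^ 2 = (Icc (-a) a).indicator (fun x ↦ ‖u x‖ ^ 2) x := by
    filter_upwards [hu.ae_eq_zero_of_notMem] with x hx
    by_cases hm : x ∈ Icc (-a) a
    · simp [hm]
    · simp [hm, hx hm]
  have hST : ∫ x in {x : ℝ | a - r < |x|}, ‖u x‖ ^ 2 =
      ∫ x in {x : ℝ | a - r < |x|} ∩ Icc (-a) a, ‖u x‖ ^ 2 := by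
    rw [integral_congr_ae (ae_restrict_of_ae hind), setIntegral_indicator measurableSet_Icc]
  -- Step 2: the trace has measure at most `2r`
  have hTsub : {x : ℝ | a - r < |x|} ∩ Icc (-a) a ⊆ Icc (a - r) a ∪ Icc (-a) (-(a - r)) := by
    intro x hx
    obtain ⟨hxS, hxI⟩ := hx
    simp only [mem_setOf_eq] at hxS
    rcases le_or_gt 0 x with h0 | h0
    · left
      rw [abs_of_nonneg h0] at hxS
      exact ⟨hxS.le, hxI.2⟩
    · right
      rw [abs_of_neg h0] at hxS
      exact ⟨hxI.1, by linarith⟩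
  have hUfin : volume (Icc (a - r) a ∪ Icc (-a) (-(a - r))) < ∞ :=
    lt_of_le_of_lt (measure_union_le _ _)
      (by simp [Real.volume_Icc] : volume (Icc (a - r) a) + volume (Icc (-a) (-(a - r))) < ∞)
  have hTfin : volume ({x : ℝ | a - r < |x|} ∩ Icc (-a) a) < ∞ := (measure_mono hTsub).trans_lt hUfin
  have hTreal : volume.real ({x : ℝ | a - r < |x|} ∩ Icc (-a) a) ≤ 2 * r := by
    calc volume.real ({x : ℝ | a - r < |x|} ∩ Icc (-a) a)
        ≤ volume.real (Icc (a - r) a ∪ Icc (-a) (-(a - r))) := measureReal_mono hTsub hUfin.ne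
      _ ≤ volume.real (Icc (a - r) a) + volume.real (Icc (-a) (-(a - r))) := measureReal_union_le _ _
      _ = r + r := by
          rw [Real.volume_real_Icc_of_le (by linarith), Real.volume_real_Icc_of_le (by linarith)]
          ring
      _ = 2 * r := by ring
  -- Step 3: a.e. on the trace, `‖u x‖² ≤ c / log(1/r)`
  have hbd : ∀ᵐ x : ℝ, x ∈ {x : ℝ | a - r < |x|} ∩ Icc (-a) a →
      ‖(‖u x‖ ^ 2 : ℝ)‖ ≤ c / Real.log (1 / r) := by
    filter_upwards [hPx, Measure.ae_ne volume a, Measure.ae_ne volume (-a)]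
      with x hx hxa hxna
    intro hxT
    obtain ⟨hxS, hxI⟩ := hxT
    simp only [mem_setOf_eq] at hxS
    rw [Real.norm_of_nonneg (by positivity)]
    have hxa' : |x| < a := by
      rcases (abs_le.2 ⟨hxI.1, hxI.2⟩).lt_or_eq with hlt | heq
      · exact hlt
      · exfalso
        rcases le_or_gt 0 x with h0 | h0
        · rw [abs_of_nonneg h0] at heq
          exact hxa heq
        · rw [abs_of_neg h0] at heq
          exact hxna (by linarith)
    have hd : 0 < a - |x| := sub_pos.2 hxa'
    have hdr : a - |x| < r := by linarith
    have hlogx : Real.log (1 / r) ≤ Real.log (1 / (a - |x|)) :=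
      Real.log_le_log (by positivity) (one_div_le_one_div_of_le hd hdr.le)
    have hlogx0 : 0 < Real.log (1 / (a - |x|)) := hlogr.trans_le hlogx
    have h1 : ‖u x‖ ^ 2 * Real.log (1 / (a - |x|)) ≤ c := hx (by linarith) hxa'
    calc ‖u x‖ ^ 2 ≤ c / Real.log (1 / (a - |x|)) := by
          rw [le_div_iff₀ hlogx0]
          exact h1
      _ ≤ c / Real.log (1 / r) :=
          div_le_div_of_nonneg_left hc0 hlogr hlogx
  -- Step 4: assemble
  have hnorm := norm_setIntegral_le_of_norm_le_const_ae' hTfin hbd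
  rw [hST]
  calc ∫ x in {x : ℝ | a - r < |x|} ∩ Icc (-a) a, ‖u x‖ ^ 2
      ≤ ‖∫ x in {x : ℝ | a - r < |x|} ∩ Icc (-a) a, ‖u x‖ ^ 2‖ := Real.le_norm_self _
    _ ≤ c / Real.log (1 / r) * volume.real ({x : ℝ | a - r < |x|} ∩ Icc (-a) a) := hnorm
    _ ≤ c / Real.log (1 / r) * (2 * r) := mul_le_mul_of_nonneg_left hTreal hc0'
    _ = (2 * K * weilGroundEnergy a + η) * r / Real.log (1 / r) := by
        simp only [hcdef]
        ring

/-! ### Calibration (sorry-free; NOT a stub): the relative law contains the sibling line's absolute law -/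

/-- **(B♭) implies the ABSOLUTE `L²` edge-mass law on the same range** (the registered bet `stub_edgeMassLaw`/(B) of
the sibling line `cut-dont-squeeze` for crux `WindowLipschitz`, item 1039): take `η = 1` and
`K_abs := K · max(ε(b₀), 0) + 1`, using `ε(a) ≤ ε(b₀)` on the range (antitone).  Consequences recorded in the line card:
(B♭) is at least as strong as the unconditional regularity bet of the sibling line (exponent ½ in `L²`-average), it
inherits that law's load-bearing floor `0 < b₀` (`Theorems/WindowLipschitz/Negative/CutDontSqueezeFloors.lean`:
`edgeMassLaw_false_without_floor`, `edgeMassLaw_constant_lower_bound`), and — conversely — on a range where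
`min ε > 0` (under RH: route item StrictUnderRH + the PROVED continuity of `ε`) the absolute law gives (B♭) back with
`K := K_abs / min ε`: the RH content of (B♭) is exactly "edge mass relative to a POSITIVE energy". -/
theorem absEdgeMassLaw_of_rel
    (hB : ∀ b₀ A : ℝ, 0 < b₀ → b₀ ≤ A → ∃ K : ℝ, 0 ≤ K ∧ ∀ η : ℝ, 0 < η → ∃ r₀ : ℝ, 0 < r₀ ∧ r₀ < 1 ∧
      ∀ (a r : ℝ) (u : ℝ → ℂ), b₀ ≤ a → a ≤ A → IsWeilGroundState a u → 0 < r → r ≤ r₀ →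
        ∫ x in {x : ℝ | a - r < |x|}, ‖u x‖ ^ 2 ≤
          (K * weilGroundEnergy a + η) * r / Real.log (1 / r)) :
    ∀ b₀ A : ℝ, 0 < b₀ → b₀ ≤ A → ∃ K d₀ : ℝ, 0 < d₀ ∧ d₀ < 1 ∧
      ∀ (a r : ℝ) (u : ℝ → ℂ), b₀ ≤ a → a ≤ A → IsWeilGroundState a u → 0 < r → r ≤ d₀ →
        ∫ x in {x : ℝ | a - r < |x|}, ‖u x‖ ^ 2 ≤ K * r / Real.log (1 / r) := by
  intro b₀ A hb₀ hb₀A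
  obtain ⟨K, hK0, hK⟩ := hB b₀ A hb₀ hb₀A
  obtain ⟨r₀, hr₀, hr₀1, hB1⟩ := hK 1 one_pos
  refine ⟨K * max (weilGroundEnergy b₀) 0 + 1, r₀, hr₀, hr₀1, ?_⟩
  intro a r u ha haA hu hr hrd
  have hr1 : r < 1 := lt_of_le_of_lt hrd hr₀1
  have hlogr : 0 < Real.log (1 / r) := by
    apply Real.log_pos
    rw [lt_div_iff₀ hr, one_mul]
    exact hr1
  have h1 := hB1 a r u ha haA hu hr hrd
  have h2 : K * weilGroundEnergy a + 1 ≤ K * max (weilGroundEnergy b₀) 0 + 1 := by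
    have e : weilGroundEnergy a ≤ max (weilGroundEnergy b₀) 0 :=
      (weilGroundEnergy_antitone hb₀ ha).trans (le_max_left _ _)
    linarith [mul_le_mul_of_nonneg_left e hK0]
  have h3 : (K * weilGroundEnergy a + 1) * r / Real.log (1 / r) ≤
      (K * max (weilGroundEnergy b₀) 0 + 1) * r / Real.log (1 / r) := by
    apply div_le_div_of_nonneg_right _ hlogr.le
    exact mul_le_mul_of_nonneg_right h2 hr.le
  exact h1.trans h3

end Summit.RiemannHypothesis.RiemannHypothesis.Cruxes.DiniLeakage.CollarCutEdgeMass

end
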